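import Summits.HodgeConjecture.HodgeConjecture.Theses.TropicalWeilObstruction
import Summits.HodgeConjecture.HodgeConjecture.Theorems.TropicalWeilObstructionTropicalHodgeBoundWeilPairing
import Mathlib.Analysis.Matrix.Order
import Mathlib.LinearAlgebra.Matrix.Rank
import HarnessLib

/-!
# Route `TropicalWeilObstruction` (Kontsevich's tropical test — NEGATION SINK, exploration, no summit claim):
# the theta class `θ₄(Q)` and Zharkov's tropical Weil classes `Re w(Q)`, `Im w(Q)` are killed by the
# eigenwave

Negation-sink bookkeeping of the cell `pub-hodge-tropical` (seat tropical-2): the honest-framing point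
§3(c) of the seat's independent read `K3-READ.md` of the closed crux K3 (`TropicalHodgeBound`, p322554).
K3 proves that at a Weil-generic period every tropical `(4,4)`-CYCLE class lies in `⟨θ₄, Re w, Im w⟩_ℚ`; the
reading "K1 (`TropicalWeilVanishing`) ⟺ the tropical Hodge conjecture fails in bidegree `(4,4)` on the very
general tropical Weil eightfold" needs, in addition, that `θ₄(Q)`, `Re w(Q)`, `Im w(Q)` ARE tropical Hodge
classes: rational classes in the kernel of the eigenwave [cite: Zharkov2020TropicalWeil, p. 1: "the tropical
Hodge `(p,p)`-classes [are] the kernel of the eigenwave action map `φ : ⋀ᵖΓ₁ ⊗ ⋀ᵖΓ₂ → ⋀ᵖ⁻¹Γ₁ ⊗ ⋀ᵖ⁺¹V`";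
p. 2: the Weil classes are "two extra Hodge `(2,2)`-classes … in `(⋀²Γ₁ ⊗ ⋀²Γ₂) ∩ ker φ`", worked out for
`g = 4`]. This file supplies the eigenwave half, in the coordinates of the landed cell identity
`cyc_eigenwave` (file `…TropicalHodgeBoundEigenwave`, p317436):

  `Σ_{m : Fin 5} (-1)^m · C (K' ∘ m.succAbove) (K'_m :: J') = 0`  for all `K' : Fin 5 → Fin 8`, `J' : Fin 3 → Fin 8`

(one vector moved between the two factors of `⋀⁴ ⊗ ⋀⁴`; for classes whose coordinate table is SYMMETRIC —
`cyc Z`, `θ₄(Q)`, `w(Q)` all are, see `thetaClass_symm`, `weilClassC_symm` — this is the same condition as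
Zharkov's `φ(C) = 0`, which moves the vector the other way).

* `sum_det_mul_submatrix_mul_det_submatrix_cons_eq_zero` — the cell identity for a PAIR of matrices over a
  field: if the columns of `X` are combinations of the columns of `Y` (`X = Y M`) then
  `Σ_m (-1)^m det X[K'∘m̂, ·] · det Y[K'_m :: J', ·] = 0` (five columns in a four-dimensional column space).
* `thetaClass_eigenwave` — for `Q` positive semidefinite, `Q = RᵀR` and all-maps Cauchy–Binet give
  `θ₄(Q) = (1/4!) Σ_I r_I ⊗ r_I` with `r_I` the Plücker vector of the rows `I` of `R`: a positive combination of
  decomposable squares, each killed by the cell identity.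
* `map_mul_omega_eq_omega_mul` — for `QJ = JQ` the period matrix preserves `V^{1,0} = span Ω`:
  `Q Ω = Ω M_Q` with `(M_Q)_{kl} = Q_{kl} + i Q_{k+n,l}` (general `n`); hence
  `weilClassC_eigenwave`, `weilClassRe_eigenwave`, `weilClassIm_eigenwave` (`n = 4`).

The companion file `…TropicalHodgeBoundIntegralHodgeLattice` adds integrality and, with K3's kernel-checked
certificate, the EXACT integral Hodge lattice `ℤθ₄ ⊕ ℤ Re w ⊕ ℤ Im w` at a Weil-generic period.
HONEST STATUS. Linear algebra only; nothing here bears on the Hodge conjecture or decides the open crux K1.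
No definition, no named fact, no sorry.
References: [Zharkov2020TropicalWeil] I. Zharkov, arXiv:2002.02347, pp. 1–2; [MikhalkinZharkov2014Eigenwave]
G. Mikhalkin, I. Zharkov, LN UMI 15 (2014), §5.1, Thm. 5.4.
-/

set_option linter.dupNamespace false

noncomputable section

open scoped BigOperators
open Matrix
open Literature.AlgebraicGeometry.Tropical

namespace Summit.HodgeConjecture.HodgeConjecture.Theorems.TropicalHodgeBound

/-! ## §0 Display-only notation (the K3 skeleton's local definitions, verbatim bodies; nothing is defined) -/

/-- `P = [1 | i·1]`, the `n × 2n` matrix of `dz₁ ∧ … ∧ dz_n`. -/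
local notation3 (prettyPrint := false) "𝐏⟦" n "⟧" =>
  (Matrix.of fun (k : Fin n) (a : Fin (2 * n)) =>
    (if (a : ℕ) = (k : ℕ) then (1 : ℂ) else 0) + (if (a : ℕ) = (k : ℕ) + n then Complex.I else 0))

/-- The skeleton's `thetaClass n Q`. -/
local notation3 (prettyPrint := false) "θ⟦" n "⟧" Q:max =>
  (fun S S' : Fin n → Fin (2 * n) => Matrix.det (Matrix.submatrix Q S S'))

/-- The skeleton's `omegaFrame n` (`Ω = Pᴴ`). -/
local notation3 (prettyPrint := false) "Ω⟦" n "⟧" =>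
  (Matrix.of fun (a : Fin (2 * n)) (b : Fin n) =>
    (if (a : ℕ) = (b : ℕ) then (1 : ℂ) else 0) - (if (a : ℕ) = (b : ℕ) + n then Complex.I else 0))

/-- The skeleton's `weilClassC n Q` (`w(Q) = (⋀ⁿQ ⊗ 1)(Ω ⊗ Ω)`). -/
local notation3 (prettyPrint := false) "wC⟦" n "⟧" Q:max =>
  (fun S S' : Fin n → Fin (2 * n) =>
    Matrix.det (Matrix.submatrix (Matrix.map Q ((↑) : ℝ → ℂ) * Ω⟦n⟧) S id) *
      Matrix.det (Matrix.submatrix (Ω⟦n⟧) S' id))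

/-- The skeleton's `weilClassRe n Q` (`w₁ = Re w`). -/
local notation3 (prettyPrint := false) "wRe⟦" n "⟧" Q:max =>
  (fun S S' : Fin n → Fin (2 * n) => Complex.re ((wC⟦n⟧ Q) S S'))

/-- The skeleton's `weilClassIm n Q` (`w₂ = Im w`). -/
local notation3 (prettyPrint := false) "wIm⟦" n "⟧" Q:max =>
  (fun S S' : Fin n → Fin (2 * n) => Complex.im ((wC⟦n⟧ Q) S S'))

/-- NEW display-only notation: `M_Q := ½ · P Q Pᴴ`, the matrix of `Q|_{V^{1,0}}` in the frame `Ω`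
(for `QJ = JQ`: `(M_Q)_{kl} = Q_{kl} + i·Q_{k+n,l}` and `QΩ = Ω M_Q`). Nothing is defined. -/
local notation3 (prettyPrint := false) "𝐌⟦" n "⟧" Q:max =>
  ((2 : ℂ)⁻¹ • (𝐏⟦n⟧ * Matrix.map Q ((↑) : ℝ → ℂ) * (𝐏⟦n⟧)ᴴ))

/-! ## §1 The cell identity for a pair of matrices over a field -/

section PairIdentity

variable {K : Type*} [Field K] {g : ℕ}

/-- Laplace expansion along the first row of the `(k :: J')`-row-selected `4 × 4` minor:
`det Y[k :: J', ·] = Σ_c (-1)^c Y_{k,c} det Y[J', ĉ]`. [folklore] -/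
theorem det_submatrix_cons_eq_sum (Y : Matrix (Fin g) (Fin 4) K) (k : Fin g) (J' : Fin 3 → Fin g) :
    (Y.submatrix (Fin.cons k J' : Fin 4 → Fin g) id).det =
      ∑ c : Fin 4, (-1) ^ (c : ℕ) * Y k c * (Y.submatrix J' c.succAbove).det := by
  rw [Matrix.det_succ_row_zero]
  refine Finset.sum_congr rfl fun c _ => ?_
  rfl

/-- Five columns in a four-dimensional column space: for `X = Y M` the `5 × 5` matrix
`[Y[K', c] | X[K', ·]]` is `Y[K', ·] · [e_c | M]`, of rank `≤ 4`, so its determinant — expanded along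
the first column, `Σ_m (-1)^m Y_{K'_m, c} det X[K' ∘ m̂, ·]` — vanishes. [folklore] -/
theorem sum_mul_det_mul_submatrix_succAbove_eq_zero (Y : Matrix (Fin g) (Fin 4) K)
    (M : Matrix (Fin 4) (Fin 4) K) (K' : Fin 5 → Fin g) (c : Fin 4) :
    ∑ m : Fin 5, (-1) ^ (m : ℕ) * Y (K' m) c *
      ((Y * M).submatrix (fun a => K' (m.succAbove a)) id).det = 0 := by
  -- the `5 × 5` matrix with the column `Y[K', c]` prepended to `X[K', ·]`
  let B : Matrix (Fin 4) (Fin 5) K :=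
    Matrix.of fun b j => (Fin.cons (if b = c then (1 : K) else 0) (fun j' : Fin 4 => M b j') : Fin 5 → K) j
  let A : Matrix (Fin 5) (Fin 5) K := Y.submatrix K' id * B
  have hA0 : ∀ m, A m 0 = Y (K' m) c := by
    intro m
    simp only [A, B, Matrix.mul_apply, Matrix.submatrix_apply, id, Matrix.of_apply, Fin.cons_zero,
      mul_ite, mul_one, mul_zero, Finset.sum_ite_eq', Finset.mem_univ, if_true]
  have hAs : ∀ m j', A m (Fin.succ j') = (Y * M) (K' m) j' := by
    intro m j'
    simp only [A, B, Matrix.mul_apply, Matrix.submatrix_apply, id, Matrix.of_apply, Fin.cons_succ]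
  -- rank bound: `rank A ≤ rank B ≤ 4 < 5`, so `A` is not invertible and `det A = 0`
  have hdet : A.det = 0 := by
    by_contra h
    have hU : IsUnit A := (Matrix.isUnit_iff_isUnit_det A).mpr (Ne.isUnit h)
    have h5 : A.rank = 5 := by simpa using Matrix.rank_of_isUnit A hU
    have h4 : A.rank ≤ 4 := (Matrix.rank_mul_le_right _ _).trans (Matrix.rank_le_height B)
    omega
  -- expansion along the first column
  have hexp : A.det = ∑ m : Fin 5, (-1) ^ (m : ℕ) * Y (K' m) c *
      ((Y * M).submatrix (fun a => K' (m.succAbove a)) id).det := by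
    rw [Matrix.det_succ_column_zero]
    refine Finset.sum_congr rfl fun m _ => ?_
    have hsub : A.submatrix m.succAbove Fin.succ = (Y * M).submatrix (fun a => K' (m.succAbove a)) id := by
      ext a j'
      simp only [Matrix.submatrix_apply, hAs, id]
    rw [hA0, hsub]
  rw [← hexp, hdet]

/-- **The cell identity for a pair `X = Y M`:** `Σ_m (-1)^m det X[K' ∘ m̂, ·] · det Y[K'_m :: J', ·] = 0`
(Laplace along the first row of the second factor, then the previous lemma column by column). With
`Y = X = L` an integer frame this is `l_j ∧ vol_σ = 0`, the identity behind `cyc_eigenwave`.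
[cite: MikhalkinZharkov2014Eigenwave, Thm. 5.4] -/
theorem sum_det_mul_submatrix_mul_det_submatrix_cons_eq_zero (Y : Matrix (Fin g) (Fin 4) K)
    (M : Matrix (Fin 4) (Fin 4) K) (K' : Fin 5 → Fin g) (J' : Fin 3 → Fin g) :
    ∑ m : Fin 5, (-1) ^ (m : ℕ) * ((Y * M).submatrix (fun a => K' (m.succAbove a)) id).det *
      (Y.submatrix (Fin.cons (K' m) J' : Fin 4 → Fin g) id).det = 0 := by
  calc ∑ m : Fin 5, (-1) ^ (m : ℕ) * ((Y * M).submatrix (fun a => K' (m.succAbove a)) id).det *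
        (Y.submatrix (Fin.cons (K' m) J' : Fin 4 → Fin g) id).det
      = ∑ m : Fin 5, ∑ c : Fin 4, (-1) ^ (c : ℕ) * (Y.submatrix J' c.succAbove).det *
          ((-1) ^ (m : ℕ) * Y (K' m) c * ((Y * M).submatrix (fun a => K' (m.succAbove a)) id).det) := by
        refine Finset.sum_congr rfl fun m _ => ?_
        rw [det_submatrix_cons_eq_sum, Finset.mul_sum]
        refine Finset.sum_congr rfl fun c _ => ?_
        ring
    _ = ∑ c : Fin 4, (-1) ^ (c : ℕ) * (Y.submatrix J' c.succAbove).det *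
          ∑ m : Fin 5, (-1) ^ (m : ℕ) * Y (K' m) c *
            ((Y * M).submatrix (fun a => K' (m.succAbove a)) id).det := by
        rw [Finset.sum_comm]
        refine Finset.sum_congr rfl fun c _ => ?_
        rw [Finset.mul_sum]
    _ = 0 := Finset.sum_eq_zero fun c _ => by
        rw [sum_mul_det_mul_submatrix_succAbove_eq_zero, mul_zero]

end PairIdentity

/-! ## §2 The theta class: `θ₄(Q)` is a positive combination of decomposable squares, hence killed -/

section Theta

/-- For `Q = Rᵀ R`: `det Q[S,S'] = (1/4!) Σ_I det R[I,S] · det R[I,S']` (all-maps Cauchy–Binet) — the theta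
class is an average of decomposable squares `r_I ⊗ r_I`. [folklore] -/
theorem det_submatrix_transpose_mul_self_eq_sum {m : Type*} [Fintype m] [DecidableEq m]
    (R : Matrix m (Fin (2 * 4)) ℝ) (S S' : Fin 4 → Fin (2 * 4)) :
    (24 : ℝ) * ((Rᵀ * R).submatrix S S').det =
      ∑ I : Fin 4 → m, (R.submatrix I S).det * (R.submatrix I S').det := by
  have h := sum_det_submatrix_mul_det_submatrix (Rᵀ.submatrix S id) (R.submatrix id S')
  simp only [Matrix.submatrix_submatrix, Function.comp_id, Function.id_comp] at h
  rw [← Matrix.submatrix_mul _ _ _ _ _ Function.bijective_id] at h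
  have h24 : ((Nat.factorial 4 : ℕ) : ℝ) = 24 := by norm_num [Nat.factorial]
  rw [h24] at h
  rw [← h]
  refine Finset.sum_congr rfl fun I _ => ?_
  rw [← Matrix.transpose_submatrix, Matrix.det_transpose]

open scoped MatrixOrder ComplexOrder in
/-- A positive semidefinite real matrix is a Gram matrix: `Q = Rᵀ R`. [folklore] -/
theorem exists_eq_transpose_mul_self_of_posSemidef {m : Type*} [Fintype m] [DecidableEq m]
    (Q : Matrix m m ℝ) (hQ : Q.PosSemidef) : ∃ R : Matrix m m ℝ, Q = Rᵀ * R := by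
  obtain ⟨B, hB⟩ := CStarAlgebra.nonneg_iff_eq_star_mul_self.mp hQ.nonneg
  refine ⟨B, ?_⟩
  rw [hB, Matrix.star_eq_conjTranspose, Matrix.conjTranspose_eq_transpose_of_trivial]

/-- **The theta class is killed by the eigenwave** (`Q` positive semidefinite):
`Σ_m (-1)^m θ₄(Q)(K' ∘ m̂, K'_m :: J') = 0`. [cite: Zharkov2020TropicalWeil, p. 2: "`θ` … is always a Hodge
class"] [cite: MikhalkinZharkov2014Eigenwave, Thm. 5.4] -/
theorem thetaClass_eigenwave (Q : Matrix (Fin (2 * 4)) (Fin (2 * 4)) ℝ) (hQ : Q.PosSemidef)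
    (K' : Fin 5 → Fin (2 * 4)) (J' : Fin 3 → Fin (2 * 4)) :
    ∑ m : Fin 5, (-1 : ℝ) ^ (m : ℕ) *
      (θ⟦4⟧ Q) (fun a => K' (m.succAbove a)) (Fin.cons (K' m) J') = 0 := by
  obtain ⟨R, rfl⟩ := exists_eq_transpose_mul_self_of_posSemidef Q hQ
  beta_reduce
  -- the rows `I` of `R` as an `8 × 4` real frame `Y_I = (R[I,·])ᵀ`; its Plücker coordinates are `det R[I,S]`
  have hY : ∀ (I S : Fin 4 → Fin (2 * 4)),
      (((R.submatrix I id)ᵀ).submatrix S id).det = (R.submatrix I S).det := by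
    intro I S
    rw [Matrix.transpose_submatrix, Matrix.submatrix_submatrix, Function.comp_id, Function.id_comp,
      ← Matrix.transpose_submatrix, Matrix.det_transpose]
  -- multiply by `24` and expand each theta coordinate as a sum of squares
  have h24 : (24 : ℝ) ≠ 0 := by norm_num
  apply mul_left_cancel₀ h24
  rw [mul_zero, Finset.mul_sum]
  calc ∑ m : Fin 5, 24 * ((-1 : ℝ) ^ (m : ℕ) *
        ((Rᵀ * R).submatrix (fun a => K' (m.succAbove a)) (Fin.cons (K' m) J')).det)
      = ∑ m : Fin 5, ∑ I : Fin 4 → Fin (2 * 4), (-1 : ℝ) ^ (m : ℕ) *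
          ((R.submatrix I (fun a => K' (m.succAbove a))).det *
            (R.submatrix I (Fin.cons (K' m) J')).det) := by
        refine Finset.sum_congr rfl fun m _ => ?_
        rw [mul_left_comm, det_submatrix_transpose_mul_self_eq_sum, Finset.mul_sum]
    _ = ∑ I : Fin 4 → Fin (2 * 4), ∑ m : Fin 5, (-1 : ℝ) ^ (m : ℕ) *
          (((R.submatrix I id)ᵀ * (1 : Matrix (Fin 4) (Fin 4) ℝ)).submatrix
              (fun a => K' (m.succAbove a)) id).det *
            (((R.submatrix I id)ᵀ).submatrix (Fin.cons (K' m) J' : Fin 4 → Fin (2 * 4)) id).det := by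
        rw [Finset.sum_comm]
        refine Finset.sum_congr rfl fun I _ => Finset.sum_congr rfl fun m _ => ?_
        rw [Matrix.mul_one, hY, hY, mul_assoc]
    _ = 0 := Finset.sum_eq_zero fun I _ =>
        sum_det_mul_submatrix_mul_det_submatrix_cons_eq_zero _ _ K' J'

/-- The theta table is symmetric for symmetric `Q`: `θ_n(Q)(S,S') = θ_n(Q)(S',S)` (so the identity above
is also Zharkov's `φ(θ) = 0`, which moves the vector the other way). [folklore] -/
theorem thetaClass_symm {n : ℕ} (Q : Matrix (Fin (2 * n)) (Fin (2 * n)) ℝ) (hS : Qᵀ = Q)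
    (S S' : Fin n → Fin (2 * n)) : (θ⟦n⟧ Q) S S' = (θ⟦n⟧ Q) S' S := by
  beta_reduce
  rw [← Matrix.det_transpose, Matrix.transpose_submatrix, hS]

end Theta

/-! ## §3 The Weil classes: `QΩ = Ω M_Q` for `QJ = JQ`, hence killed -/

section Weil

variable {n : ℕ}

/-- `J`-commutation, entrywise (i): `Q_{k,l+n} = -Q_{k+n,l}` (`Q = [[A,B],[-B,A]]`, the `B`-block).
[cite: Zharkov2020TropicalWeil, §2] -/
theorem apply_lo_hi_of_weilJ_comm (Q : Matrix (Fin (2 * n)) (Fin (2 * n)) ℝ)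
    (hJ : Q * weilJ n = weilJ n * Q) (k l : Fin n) :
    Q ⟨(k : ℕ), by omega⟩ ⟨(l : ℕ) + n, by omega⟩ = - Q ⟨(k : ℕ) + n, by omega⟩ ⟨(l : ℕ), by omega⟩ := by
  have h1 := congrFun (congrFun hJ ⟨(k : ℕ), by omega⟩) ⟨(l : ℕ), by omega⟩
  rwa [mul_weilJ_apply_lo, weilJ_mul_apply_lo] at h1

/-- `J`-commutation, entrywise (ii): `Q_{k+n,l+n} = Q_{k,l}` (the two `A`-blocks agree).
[cite: Zharkov2020TropicalWeil, §2] -/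
theorem apply_hi_hi_of_weilJ_comm (Q : Matrix (Fin (2 * n)) (Fin (2 * n)) ℝ)
    (hJ : Q * weilJ n = weilJ n * Q) (k l : Fin n) :
    Q ⟨(k : ℕ) + n, by omega⟩ ⟨(l : ℕ) + n, by omega⟩ = Q ⟨(k : ℕ), by omega⟩ ⟨(l : ℕ), by omega⟩ := by
  have h2 := congrFun (congrFun hJ ⟨(k : ℕ), by omega⟩) ⟨(l : ℕ) + n, by omega⟩
  rw [mul_weilJ_apply_hi, weilJ_mul_apply_lo] at h2
  exact (neg_inj.mp h2).symm

/-- **`P Q Pᴴ = 2 (A - iB)` entrywise** for `QJ = JQ`: `(P Q Pᴴ)_{kl} = 2 (Q_{kl} + i Q_{k+n,l})`.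
[cite: Zharkov2020TropicalWeil, §2] -/
theorem frame_mul_map_mul_frame_conjTranspose_apply (Q : Matrix (Fin (2 * n)) (Fin (2 * n)) ℝ)
    (hJ : Q * weilJ n = weilJ n * Q) (k l : Fin n) :
    (𝐏⟦n⟧ * Q.map ((↑) : ℝ → ℂ) * (𝐏⟦n⟧)ᴴ) k l =
      2 * (((Q ⟨(k : ℕ), by omega⟩ ⟨(l : ℕ), by omega⟩ : ℝ) : ℂ) +
        ((Q ⟨(k : ℕ) + n, by omega⟩ ⟨(l : ℕ), by omega⟩ : ℝ) : ℂ) * Complex.I) := by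
  rw [Matrix.mul_assoc, frame_mul_apply, mul_frame_conjTranspose_apply, mul_frame_conjTranspose_apply]
  simp only [Matrix.map_apply]
  rw [apply_lo_hi_of_weilJ_comm Q hJ, apply_hi_hi_of_weilJ_comm Q hJ]
  push_cast
  linear_combination (-((Q ⟨(k : ℕ), by omega⟩ ⟨(l : ℕ), by omega⟩ : ℝ) : ℂ)) * Complex.I_mul_I

/-- **`Q` preserves `V^{1,0}`**: for a real `Q` commuting with `J`, `Q Ω = Ω M_Q` (`M_Q = ½ P Q Pᴴ`; column
by column: `Q ω_l = Σ_k (Q_{kl} + i Q_{k+n,l}) ω_k`). [cite: Zharkov2020TropicalWeil, §2] -/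
theorem map_mul_omega_eq_omega_mul (Q : Matrix (Fin (2 * n)) (Fin (2 * n)) ℝ)
    (hJ : Q * weilJ n = weilJ n * Q) :
    Q.map ((↑) : ℝ → ℂ) * Ω⟦n⟧ = Ω⟦n⟧ * 𝐌⟦n⟧ Q := by
  -- the left entry `(a, l)`: `Q_{a,l} - i Q_{a,l+n}`
  have hL : ∀ (a : Fin (2 * n)) (l : Fin n), (Q.map ((↑) : ℝ → ℂ) * Ω⟦n⟧) a l =
      ((Q a ⟨(l : ℕ), by omega⟩ : ℝ) : ℂ) - Complex.I * ((Q a ⟨(l : ℕ) + n, by omega⟩ : ℝ) : ℂ) := by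
    intro a l
    rw [← frame_conjTranspose_eq, mul_frame_conjTranspose_apply]
    rfl
  -- the right entry `(a, l)`: `Σ_j Ω_{a,j} (Q_{jl} + i Q_{j+n,l})`
  have hR : ∀ (a : Fin (2 * n)) (l : Fin n), (Ω⟦n⟧ * 𝐌⟦n⟧ Q) a l =
      ∑ j : Fin n, ((if (a : ℕ) = (j : ℕ) then (1 : ℂ) else 0) -
          (if (a : ℕ) = (j : ℕ) + n then Complex.I else 0)) *
        (((Q ⟨(j : ℕ), by omega⟩ ⟨(l : ℕ), by omega⟩ : ℝ) : ℂ) +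
          ((Q ⟨(j : ℕ) + n, by omega⟩ ⟨(l : ℕ), by omega⟩ : ℝ) : ℂ) * Complex.I) := by
    intro a l
    rw [Matrix.mul_apply]
    refine Finset.sum_congr rfl fun j _ => ?_
    rw [Matrix.smul_apply, smul_eq_mul, frame_mul_map_mul_frame_conjTranspose_apply Q hJ, Matrix.of_apply]
    ring
  ext a l
  rw [hL, hR]
  by_cases ha : (a : ℕ) < n
  · -- `a = k < n`: only `j = k` contributes, with `Ω_{a,k} = 1`
    rw [Finset.sum_eq_single (⟨a, ha⟩ : Fin n)]
    · rw [if_pos (show ((a : ℕ)) = ((⟨a, ha⟩ : Fin n) : ℕ) from rfl),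
        if_neg (show ¬ ((a : ℕ) = (a : ℕ) + n) by omega)]
      have h1 := apply_lo_hi_of_weilJ_comm Q hJ ⟨a, ha⟩ l
      simp only [Fin.eta] at h1 ⊢
      rw [h1]
      push_cast
      ring
    · intro j _ hj
      have hj1 : ¬ ((a : ℕ) = (j : ℕ)) := fun h => hj (Fin.ext h).symm
      have hj2 : ¬ ((a : ℕ) = (j : ℕ) + n) := by omega
      rw [if_neg hj1, if_neg hj2]
      ring
    · intro h; exact absurd (Finset.mem_univ _) h
  · -- `a = k + n`: only `j = k` contributes, with `Ω_{a,k} = -i`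
    obtain ⟨k, hk⟩ : ∃ k : Fin n, (a : ℕ) = (k : ℕ) + n :=
      ⟨⟨(a : ℕ) - n, by omega⟩, (Nat.sub_add_cancel (show n ≤ (a : ℕ) by omega)).symm⟩
    rw [Finset.sum_eq_single k]
    · rw [if_neg (show ¬ ((a : ℕ) = (k : ℕ)) by omega), if_pos hk]
      have e : a = ⟨(k : ℕ) + n, by omega⟩ := Fin.ext hk
      rw [e, apply_hi_hi_of_weilJ_comm Q hJ k l]
      linear_combination (((Q ⟨(k : ℕ) + n, by omega⟩ ⟨(l : ℕ), by omega⟩ : ℝ) : ℂ)) * Complex.I_mul_I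
    · intro j _ hj
      have hj1 : ¬ ((a : ℕ) = (j : ℕ)) := by omega
      have hj2 : ¬ ((a : ℕ) = (j : ℕ) + n) := fun h => hj (Fin.ext (by omega)).symm
      rw [if_neg hj1, if_neg hj2]
      ring
    · intro h; exact absurd (Finset.mem_univ _) h

/-- **Zharkov's complex Weil class is killed by the eigenwave** (`QJ = JQ`):
`Σ_m (-1)^m w(Q)(K' ∘ m̂, K'_m :: J') = 0` — the pair identity with `Y = Ω`, `X = QΩ = Ω M_Q`.
[cite: Zharkov2020TropicalWeil, p. 2] [cite: MikhalkinZharkov2014Eigenwave, Thm. 5.4] -/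
theorem weilClassC_eigenwave (Q : Matrix (Fin (2 * 4)) (Fin (2 * 4)) ℝ)
    (hJ : Q * weilJ 4 = weilJ 4 * Q) (K' : Fin 5 → Fin (2 * 4)) (J' : Fin 3 → Fin (2 * 4)) :
    ∑ m : Fin 5, (-1 : ℂ) ^ (m : ℕ) *
      (wC⟦4⟧ Q) (fun a => K' (m.succAbove a)) (Fin.cons (K' m) J') = 0 := by
  beta_reduce
  simp_rw [map_mul_omega_eq_omega_mul Q hJ, ← mul_assoc]
  exact sum_det_mul_submatrix_mul_det_submatrix_cons_eq_zero _ _ K' J'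

/-- Real parts of a `Fin 5`-alternating complex sum. [folklore] -/
theorem re_sum_neg_one_pow_mul (z : Fin 5 → ℂ) :
    (∑ m : Fin 5, (-1 : ℂ) ^ (m : ℕ) * z m).re = ∑ m : Fin 5, (-1 : ℝ) ^ (m : ℕ) * (z m).re := by
  simp [Fin.sum_univ_five, pow_succ]

/-- Imaginary parts of a `Fin 5`-alternating complex sum. [folklore] -/
theorem im_sum_neg_one_pow_mul (z : Fin 5 → ℂ) :
    (∑ m : Fin 5, (-1 : ℂ) ^ (m : ℕ) * z m).im = ∑ m : Fin 5, (-1 : ℝ) ^ (m : ℕ) * (z m).im := by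
  simp [Fin.sum_univ_five, pow_succ]

/-- **`Re w(Q)` is killed by the eigenwave** (`QJ = JQ`). [cite: Zharkov2020TropicalWeil, p. 2] -/
theorem weilClassRe_eigenwave (Q : Matrix (Fin (2 * 4)) (Fin (2 * 4)) ℝ)
    (hJ : Q * weilJ 4 = weilJ 4 * Q) (K' : Fin 5 → Fin (2 * 4)) (J' : Fin 3 → Fin (2 * 4)) :
    ∑ m : Fin 5, (-1 : ℝ) ^ (m : ℕ) *
      (wRe⟦4⟧ Q) (fun a => K' (m.succAbove a)) (Fin.cons (K' m) J') = 0 := by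
  have h := congrArg Complex.re (weilClassC_eigenwave Q hJ K' J')
  rw [re_sum_neg_one_pow_mul, Complex.zero_re] at h
  exact h

/-- **`Im w(Q)` is killed by the eigenwave** (`QJ = JQ`). [cite: Zharkov2020TropicalWeil, p. 2] -/
theorem weilClassIm_eigenwave (Q : Matrix (Fin (2 * 4)) (Fin (2 * 4)) ℝ)
    (hJ : Q * weilJ 4 = weilJ 4 * Q) (K' : Fin 5 → Fin (2 * 4)) (J' : Fin 3 → Fin (2 * 4)) :
    ∑ m : Fin 5, (-1 : ℝ) ^ (m : ℕ) *
      (wIm⟦4⟧ Q) (fun a => K' (m.succAbove a)) (Fin.cons (K' m) J') = 0 := by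
  have h := congrArg Complex.im (weilClassC_eigenwave Q hJ K' J')
  rw [im_sum_neg_one_pow_mul, Complex.zero_im] at h
  exact h

/-- `w(Q)(S,S') = det M_Q · det Ω[S] · det Ω[S']` for `QJ = JQ` (general `n`; `det M_Q = det (P Q Pᴴ) / 2ⁿ`):
the complex Weil class is `det(Q|_{V^{1,0}}) · Ω ⊗ Ω`, a SYMMETRIC table of complex rank one.
[cite: Zharkov2020TropicalWeil, §2] -/
theorem weilClassC_eq_det_mul (Q : Matrix (Fin (2 * n)) (Fin (2 * n)) ℝ)
    (hJ : Q * weilJ n = weilJ n * Q) (S S' : Fin n → Fin (2 * n)) :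
    (wC⟦n⟧ Q) S S' =
      (𝐌⟦n⟧ Q).det * (((Ω⟦n⟧).submatrix S id).det * ((Ω⟦n⟧).submatrix S' id).det) := by
  beta_reduce
  rw [map_mul_omega_eq_omega_mul Q hJ,
    show (Ω⟦n⟧ * 𝐌⟦n⟧ Q).submatrix S id = (Ω⟦n⟧).submatrix S id * 𝐌⟦n⟧ Q from rfl,
    Matrix.det_mul]
  ring

/-- The Weil table is symmetric for `QJ = JQ`: `w(Q)(S,S') = w(Q)(S',S)` (so `weilClassC_eigenwave` is also
Zharkov's `φ(w) = 0`). [cite: Zharkov2020TropicalWeil, §2] -/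
theorem weilClassC_symm (Q : Matrix (Fin (2 * n)) (Fin (2 * n)) ℝ)
    (hJ : Q * weilJ n = weilJ n * Q) (S S' : Fin n → Fin (2 * n)) :
    (wC⟦n⟧ Q) S S' = (wC⟦n⟧ Q) S' S := by
  rw [weilClassC_eq_det_mul Q hJ, weilClassC_eq_det_mul Q hJ]
  ring

end Weil

end Summit.HodgeConjecture.HodgeConjecture.Theorems.TropicalHodgeBound

end
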